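import Mathlib
import Summits.ValiantsHypothesis.ValiantsHypothesis.Theorems.ValuativeGCTValuativeFlipLiftSurjective
import Summits.ValiantsHypothesis.ValiantsHypothesis.Theorems.ValuativeGCTValuativeFlipLiftKernel
import Literature.Computability.AlgebraicComplexity.MultiplicityObstructionsProofs
import HarnessLib

/-!
# `ValuativeGCT.ValuativeFlip` (stmt-ValiantsHypothesis-12624): rays from the bottom, III —
# the per-side multiplicity at EVERY padding is decided at level `m`

Wall-breaker k4 (gen 1, seat 2; axis "representation-stability transfer between `m` and `m + 1`"),
helper file `--supports stmt-ValiantsHypothesis-12624`.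

Letters: `n ≤ m` (inner size, level), `λ ⊢ m·δ` with at most `m²` parts and SECOND ROW `λ₂ ≤ m`,
padding `j`, level `N = m + j`, shape `λ♯(m+j)` (`jδ` boxes added to the first row);
`P(j) := mult_{(λ♯(m+j))*} ℂ[Δ_N(X₀₀^{N-n} per_n)]` (per side of the flip body at the window position
`(n, N)`), `a := a_λ(δ[m])` (ambient plethysm coefficient at level `m`), `H := HWV_{λ*}(ℂ[Sym^m ℂ^{m²}])`
(`dim H = a`), and the **twisted kernel**
`K_j(λ) := {G ∈ H : G(Δ_j(A · X₀₀^{m-n} per_n)) = 0 for every column-normalised A ∈ Mat_{m²}}`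
(`Δ_j` = BIP's diagonal twist `x^e ↦ (e_top+j)!/e_top! · x^e`; "column-normalised" = `A·X₀₀ = X_top`
when `n < m`, no condition at the bottom `m = n`) — a linear-algebra object AT LEVEL `m`.

* `orbitMultiplicity_rowLift_add_finrank_twistKer` — **THE IDENTITY `P(j) + dim K_j(λ) = a_λ(δ[m])`
  FOR EVERY `j ≥ 0`.**  Proof: `HWV(ℂ[Δ_N f'])_{(λ♯)*}` is the image of the ambient `HWV_{(λ♯)*}`
  (complete reducibility, `map_highestWeightSpace_eq_of_surjective`), which is `L(H)` for the
  Kadish–Landsberg lift `L = liftHWV m j` (BIJECTIVE for `λ₂ ≤ m`: Part I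
  `map_liftHWV_highestWeightSpace_eq`, `liftHWV_injective`); and `L G ∈ I_N ⇔ G ∈ K_j(λ)` (Part II
  `liftHWV_mem_orbitVanishingIdeal_iff`); rank–nullity on `H`.
* `orbitMultiplicity_add_finrank_ker_bottom` — the bottom `j = 0` for EVERY shape: `P(0) + dim K_0 = a`
  with the UNtwisted kernel `K_0 = H ∩ I(Δ_m(X₀₀^{m-n} per_n))` (column-normalised points suffice; no
  lift, no condition on `λ₂`).
* `orbitMultiplicity_rowLift_le_iff_finrank_le`, `orbitMultiplicity_le_rowLift_iff` — **monotonicity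
  along the ray is a comparison of kernel dimensions at level `m`**: `P(j₁) ≤ P(j₂) ⇔ dim K_{j₂} ≤ dim K_{j₁}`;
  in particular BLMW Problem 6.10 ("≥", inheritance at EVERY padding) on these rays is EQUIVALENT to
  `dim K_j(λ) ≤ dim K_0(λ)` for all `j`, and the exceptional paddings of the eventual transfer
  (k4 gen 1 `eventualPaddingTransfer`, k12 `eventualInheritance`) are EXACTLY `{j : dim K_j > dim K_0}`.
* `orbitMultiplicity_rowLift_eq_iff_finrank_eq` — `P(j₁) = P(j₂) ⇔ dim K_{j₁} = dim K_{j₂}`.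

Meaning for the crux.  On the rays `λ₂ ≤ m` the Δ_j-twisted inner certificates of the siege programme
(`stub_twistedInheritance`, `twistedInheritance_padded`) are not only sufficient but NECESSARY: there is
no per-side multiplicity at ANY position `(n, m + j)` of the window beyond the rank of the twisted
evaluation of level-`m` highest-weight vectors at level-`m` points.  The per side of the TAIL on such
rays is an inner computation, uniformly in the padding; the stable value `P∞(λ)` (k16) is
`a − min_j dim K_j(λ)`.

Sources: BLMW, SIAM J. Comput. 40 (2011) §5.2, §6.4 (Problem 6.10); Kadish–Landsberg, Commun. Algebra 42
(2014) §1; Ikenmeyer–Panova, Adv. Math. 319 (2017) Prop. 2.6(b); Bürgisser–Ikenmeyer–Panova, J. AMS 32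
(2019) Lemma 5.2–5.3, Prop. 5.6(2), Thm. 5.4; Bläser–Ikenmeyer 2025 Cor. 12.6 (lifting of highest-weight
vectors along surjections).
-/

set_option linter.dupNamespace false

namespace Summit.ValiantsHypothesis.ValiantsHypothesis.Theorems.ValuativeFlip

open scoped BigOperators
open MvPolynomial
open Literature.NumberTheory.DiophantineGeometry
open Literature.Computability.AlgebraicComplexity
open Literature.Computability.Complexity

noncomputable section

/-! ## Linear algebra: rank–nullity for a map restricted to a subspace -/

/-- Rank–nullity on a subspace: `dim f(H) + dim (H ⊓ ker f) = dim H` (`H` finite-dimensional).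
[folklore] -/
theorem rb_finrank_map_add_finrank_inf_ker {V W : Type*} [AddCommGroup V] [Module ℂ V]
    [AddCommGroup W] [Module ℂ W] (f : V →ₗ[ℂ] W) (H : Submodule ℂ V) [FiniteDimensional ℂ H] :
    Module.finrank ℂ ↥(H.map f) + Module.finrank ℂ ↥(H ⊓ LinearMap.ker f) = Module.finrank ℂ ↥H := by
  have h := LinearMap.finrank_range_add_finrank_ker (f.domRestrict H)
  rw [LinearMap.range_domRestrict, LinearMap.ker_domRestrict] at h
  rw [← h, ← Submodule.finrank_map_subtype_eq H ((LinearMap.ker f).comap H.subtype),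
    Submodule.map_comap_subtype]

/-! ## The identity `P(j) + dim K_j(λ) = a_λ(δ[m])` -/

/-- **RAYS FROM THE BOTTOM.**  For `n ≤ m`, `m ≥ 1`, `λ ⊢ m·δ` with at most `m²` parts and second row
`λ₂ ≤ m`, and EVERY padding `j`:
`mult_{(λ♯(m+j))*} ℂ[Δ_{m+j}(X₀₀^{m+j-n} per_n)] + dim K_j(λ) = a_λ(δ[m])`, where
`K_j(λ) = {G ∈ HWV_{λ*}(ℂ[Sym^m ℂ^{m²}]) : G(Δ_j(A · X₀₀^{m-n} per_n)) = 0 ∀ column-normalised A}`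
is the twisted kernel AT LEVEL `m`.  The per-side multiplicity at every position of the ray is the rank
of the Δ_j-twisted evaluation of level-`m` highest-weight vectors at level-`m` points.
[BLMW 2011 §6.4; Bürgisser–Ikenmeyer–Panova 2019 §5; this crux, Parts I–II] -/
theorem orbitMultiplicity_rowLift_add_finrank_twistKer {n m δ : ℕ} [NeZero m] (hnm : n ≤ m)
    (lam : Nat.Partition (m * δ)) (hlam : lam.parts.card ≤ m * m) (h₂ : lam.sortedParts.getD 1 0 ≤ m)
    (j : ℕ) [NeZero (m + j)] :
    orbitMultiplicity ℂ (paddedPerFormLex ℂ n (m + j)) (m + j) (partitionWeightLex (m + j) (rowLift lam j)) +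
      Module.finrank ℂ ↥(highestWeightSpace (coordRep (MatIdx m) ℂ m) (partitionWeightLex m lam) ⊓
        ⨅ (A : Matrix (MatIdx m) (MatIdx m) ℂ)
          (_ : n < m → ∀ s, A s (toLex ((0 : Fin m), (0 : Fin m))) = if s = topMatIdx m then 1 else 0),
          LinearMap.ker (aeval (R := ℂ) (S₁ := ℂ) fun e : DegIdx (MatIdx m) m =>
            (((e.1 (topMatIdx m) + j).descFactorial j : ℕ) : ℂ) *
              coeff e.1 (linSubst (MatIdx m) ℂ A (paddedPerFormLex ℂ n m))).toLinearMap) =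
    plethysmCoeff ℂ (MatIdx m) m (partitionWeightLex m lam) := by
  set N := m + j with hN
  set f' := paddedPerFormLex ℂ n N with hf'
  set H := highestWeightSpace (coordRep (MatIdx m) ℂ m) (partitionWeightLex m lam) with hH
  haveI : FiniteDimensional ℂ ↥H := finiteDimensional_highestWeightSpace_coordRep_holds (NeZero.ne m) _
  -- the composite `mk ∘ L`
  set φ : MvPolynomial (DegIdx (MatIdx m) m) ℂ →ₗ[ℂ] OrbitCoordRing f' N :=
    (Ideal.Quotient.mkₐ ℂ (orbitVanishingIdeal f' N)).toLinearMap ∘ₗ (liftHWV m j).toLinearMap with hφ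
  -- (1) the highest-weight space of the orbit closure is `φ(H)`
  have hsurj : Function.Surjective
      (⟨(Ideal.Quotient.mkₐ ℂ (orbitVanishingIdeal f' N)).toLinearMap, fun _ => LinearMap.ext fun _ => rfl⟩ :
        (coordRep (MatIdx N) ℂ N).IntertwiningMap (orbitCoordRep f' N)) :=
    Ideal.Quotient.mkₐ_surjective ℂ _
  have h1 : highestWeightSpace (orbitCoordRep f' N) (partitionWeightLex N (rowLift lam j)) = H.map φ := by
    rw [← map_highestWeightSpace_eq_of_surjective _ hsurj (isSemisimpleRepresentation_coordRep N),
      ← map_liftHWV_highestWeightSpace_eq lam hlam h₂ j, Submodule.map_comp]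
  -- (2) the kernel of `φ` on `H` is the twisted kernel
  have h2 : H ⊓ LinearMap.ker φ = H ⊓
      ⨅ (A : Matrix (MatIdx m) (MatIdx m) ℂ)
        (_ : n < m → ∀ s, A s (toLex ((0 : Fin m), (0 : Fin m))) = if s = topMatIdx m then 1 else 0),
        LinearMap.ker (aeval (R := ℂ) (S₁ := ℂ) fun e : DegIdx (MatIdx m) m =>
          (((e.1 (topMatIdx m) + j).descFactorial j : ℕ) : ℂ) *
            coeff e.1 (linSubst (MatIdx m) ℂ A (paddedPerFormLex ℂ n m))).toLinearMap := by
    ext G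
    simp only [Submodule.mem_inf, Submodule.mem_iInf, LinearMap.mem_ker, AlgHom.toLinearMap_apply]
    constructor
    · rintro ⟨hG, hker⟩
      refine ⟨hG, fun A hA => ?_⟩
      have hmem : liftHWV m j G ∈ orbitVanishingIdeal f' N := by
        rw [← Ideal.Quotient.eq_zero_iff_mem, ← Ideal.Quotient.mkₐ_eq_mk ℂ]
        exact hker
      exact (liftHWV_mem_orbitVanishingIdeal_iff hnm lam hlam j hG).mp hmem A hA
    · rintro ⟨hG, hker⟩
      refine ⟨hG, ?_⟩
      have hmem : liftHWV m j G ∈ orbitVanishingIdeal f' N :=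
        (liftHWV_mem_orbitVanishingIdeal_iff hnm lam hlam j hG).mpr hker
      change (Ideal.Quotient.mkₐ ℂ (orbitVanishingIdeal f' N)) (liftHWV m j G) = 0
      rw [Ideal.Quotient.mkₐ_eq_mk, Ideal.Quotient.eq_zero_iff_mem]
      exact hmem
  -- (3) rank–nullity on `H`
  have h3 := rb_finrank_map_add_finrank_inf_ker φ H
  rw [h2] at h3
  unfold orbitMultiplicity plethysmCoeff hwMultiplicity
  rw [h1]
  exact h3

/-- **The bottom of the ray (`j = 0`), for every shape.**  For `m ≥ 1`, any `n`, and any `λ`: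
`mult_{λ*} ℂ[Δ_m(X₀₀^{m-n} per_n)] + dim K_0(λ) = a_λ(δ[m])` with the UNtwisted kernel
`K_0(λ) = {G ∈ HWV_{λ*} : G(A · X₀₀^{m-n} per_n) = 0 ∀ column-normalised A}` — which is
`HWV_{λ*} ∩ I(Δ_m(X₀₀^{m-n} per_n))` by Borel saturation (`mem_orbitVanishingIdeal_of_forall_col`, k4
gen 1).  No lift is involved, so no condition on `λ₂`. [BLMW 2011 §5.2; Mulmuley–Sohoni 2001 §4] -/
theorem orbitMultiplicity_add_finrank_ker_bottom {n m δ : ℕ} [NeZero m] (lam : Nat.Partition (m * δ)) :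
    orbitMultiplicity ℂ (paddedPerFormLex ℂ n m) m (partitionWeightLex m lam) +
      Module.finrank ℂ ↥(highestWeightSpace (coordRep (MatIdx m) ℂ m) (partitionWeightLex m lam) ⊓
        ⨅ (A : Matrix (MatIdx m) (MatIdx m) ℂ)
          (_ : n < m → ∀ s, A s (toLex ((0 : Fin m), (0 : Fin m))) = if s = topMatIdx m then 1 else 0),
          LinearMap.ker (aeval (R := ℂ) (S₁ := ℂ)
            (formCoeff m (linSubst (MatIdx m) ℂ A (paddedPerFormLex ℂ n m)))).toLinearMap) =
    plethysmCoeff ℂ (MatIdx m) m (partitionWeightLex m lam) := by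
  set f := paddedPerFormLex ℂ n m with hf
  set H := highestWeightSpace (coordRep (MatIdx m) ℂ m) (partitionWeightLex m lam) with hH
  haveI : FiniteDimensional ℂ ↥H := finiteDimensional_highestWeightSpace_coordRep_holds (NeZero.ne m) _
  set φ : MvPolynomial (DegIdx (MatIdx m) m) ℂ →ₗ[ℂ] OrbitCoordRing f m :=
    (Ideal.Quotient.mkₐ ℂ (orbitVanishingIdeal f m)).toLinearMap with hφ
  have hsurj : Function.Surjective
      (⟨(Ideal.Quotient.mkₐ ℂ (orbitVanishingIdeal f m)).toLinearMap, fun _ => LinearMap.ext fun _ => rfl⟩ :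
        (coordRep (MatIdx m) ℂ m).IntertwiningMap (orbitCoordRep f m)) :=
    Ideal.Quotient.mkₐ_surjective ℂ _
  have h1 : highestWeightSpace (orbitCoordRep f m) (partitionWeightLex m lam) = H.map φ := by
    rw [← map_highestWeightSpace_eq_of_surjective _ hsurj (isSemisimpleRepresentation_coordRep m)]
  have h2 : H ⊓ LinearMap.ker φ = H ⊓
      ⨅ (A : Matrix (MatIdx m) (MatIdx m) ℂ)
        (_ : n < m → ∀ s, A s (toLex ((0 : Fin m), (0 : Fin m))) = if s = topMatIdx m then 1 else 0),
        LinearMap.ker (aeval (R := ℂ) (S₁ := ℂ) (formCoeff m (linSubst (MatIdx m) ℂ A f))).toLinearMap := by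
    ext G
    simp only [Submodule.mem_inf, Submodule.mem_iInf, LinearMap.mem_ker, AlgHom.toLinearMap_apply]
    constructor
    · rintro ⟨hG, hker⟩
      refine ⟨hG, fun A _ => ?_⟩
      have hmem : G ∈ orbitVanishingIdeal f m := by
        rw [← Ideal.Quotient.eq_zero_iff_mem, ← Ideal.Quotient.mkₐ_eq_mk ℂ]
        exact hker
      exact lk_aeval_formCoeff_linSubst_eq_zero hmem A
    · rintro ⟨hG, hker⟩
      refine ⟨hG, ?_⟩
      have hmem : G ∈ orbitVanishingIdeal f m :=
        mem_orbitVanishingIdeal_of_forall_col f m (partitionWeightLex m lam) (toLex ((0 : Fin m), (0 : Fin m)))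
          (topMatIdx m) (le_topMatIdx m) hG fun g hg => hker (g : Matrix (MatIdx m) (MatIdx m) ℂ) fun _ => hg
      change (Ideal.Quotient.mkₐ ℂ (orbitVanishingIdeal f m)) G = 0
      rw [Ideal.Quotient.mkₐ_eq_mk, Ideal.Quotient.eq_zero_iff_mem]
      exact hmem
  have h3 := rb_finrank_map_add_finrank_inf_ker φ H
  rw [h2] at h3
  unfold orbitMultiplicity plethysmCoeff hwMultiplicity
  rw [h1]
  exact h3

/-! ## Monotonicity along the ray = comparison of kernel dimensions at level `m` -/

/-- **`P(j₁) ≤ P(j₂) ⇔ dim K_{j₂}(λ) ≤ dim K_{j₁}(λ)`** along the ray of `λ` (`λ₂ ≤ m`): the per-side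
multiplicities at two paddings compare as the twisted kernels at level `m` do, in reverse.  With
`j₁ = 0`: BLMW Problem 6.10 "≥" (inheritance at the padding `j₂`) holds on this ray iff
`dim K_{j₂} ≤ dim K_0`; the exceptional paddings of `eventualPaddingTransfer` are exactly
`{j : dim K_j > dim K_0}`. [BLMW 2011 §6.4 Problem 6.10; this file] -/
theorem orbitMultiplicity_rowLift_le_iff_finrank_le {n m δ : ℕ} [NeZero m] (hnm : n ≤ m)
    (lam : Nat.Partition (m * δ)) (hlam : lam.parts.card ≤ m * m) (h₂ : lam.sortedParts.getD 1 0 ≤ m)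
    (j₁ j₂ : ℕ) [NeZero (m + j₁)] [NeZero (m + j₂)] :
    orbitMultiplicity ℂ (paddedPerFormLex ℂ n (m + j₁)) (m + j₁) (partitionWeightLex (m + j₁) (rowLift lam j₁)) ≤
        orbitMultiplicity ℂ (paddedPerFormLex ℂ n (m + j₂)) (m + j₂) (partitionWeightLex (m + j₂) (rowLift lam j₂)) ↔
      Module.finrank ℂ ↥(highestWeightSpace (coordRep (MatIdx m) ℂ m) (partitionWeightLex m lam) ⊓
          ⨅ (A : Matrix (MatIdx m) (MatIdx m) ℂ)
            (_ : n < m → ∀ s, A s (toLex ((0 : Fin m), (0 : Fin m))) = if s = topMatIdx m then 1 else 0),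
            LinearMap.ker (aeval (R := ℂ) (S₁ := ℂ) fun e : DegIdx (MatIdx m) m =>
              (((e.1 (topMatIdx m) + j₂).descFactorial j₂ : ℕ) : ℂ) *
                coeff e.1 (linSubst (MatIdx m) ℂ A (paddedPerFormLex ℂ n m))).toLinearMap) ≤
        Module.finrank ℂ ↥(highestWeightSpace (coordRep (MatIdx m) ℂ m) (partitionWeightLex m lam) ⊓
          ⨅ (A : Matrix (MatIdx m) (MatIdx m) ℂ)
            (_ : n < m → ∀ s, A s (toLex ((0 : Fin m), (0 : Fin m))) = if s = topMatIdx m then 1 else 0),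
            LinearMap.ker (aeval (R := ℂ) (S₁ := ℂ) fun e : DegIdx (MatIdx m) m =>
              (((e.1 (topMatIdx m) + j₁).descFactorial j₁ : ℕ) : ℂ) *
                coeff e.1 (linSubst (MatIdx m) ℂ A (paddedPerFormLex ℂ n m))).toLinearMap) := by
  have h1 := orbitMultiplicity_rowLift_add_finrank_twistKer hnm lam hlam h₂ j₁
  have h2 := orbitMultiplicity_rowLift_add_finrank_twistKer hnm lam hlam h₂ j₂
  omega

/-- **`P(j₁) = P(j₂) ⇔ dim K_{j₁}(λ) = dim K_{j₂}(λ)`** along the ray of `λ` (`λ₂ ≤ m`); in particular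
the ray is CONSTANT from the start (`P(j) = P(0)` for all `j`, BLMW Problem 6.10 with equality) iff all
twisted kernels at level `m` have the dimension of the untwisted one. [BLMW 2011 §6.4; this file] -/
theorem orbitMultiplicity_rowLift_eq_iff_finrank_eq {n m δ : ℕ} [NeZero m] (hnm : n ≤ m)
    (lam : Nat.Partition (m * δ)) (hlam : lam.parts.card ≤ m * m) (h₂ : lam.sortedParts.getD 1 0 ≤ m)
    (j₁ j₂ : ℕ) [NeZero (m + j₁)] [NeZero (m + j₂)] :
    orbitMultiplicity ℂ (paddedPerFormLex ℂ n (m + j₁)) (m + j₁) (partitionWeightLex (m + j₁) (rowLift lam j₁)) =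
        orbitMultiplicity ℂ (paddedPerFormLex ℂ n (m + j₂)) (m + j₂) (partitionWeightLex (m + j₂) (rowLift lam j₂)) ↔
      Module.finrank ℂ ↥(highestWeightSpace (coordRep (MatIdx m) ℂ m) (partitionWeightLex m lam) ⊓
          ⨅ (A : Matrix (MatIdx m) (MatIdx m) ℂ)
            (_ : n < m → ∀ s, A s (toLex ((0 : Fin m), (0 : Fin m))) = if s = topMatIdx m then 1 else 0),
            LinearMap.ker (aeval (R := ℂ) (S₁ := ℂ) fun e : DegIdx (MatIdx m) m =>
              (((e.1 (topMatIdx m) + j₁).descFactorial j₁ : ℕ) : ℂ) *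
                coeff e.1 (linSubst (MatIdx m) ℂ A (paddedPerFormLex ℂ n m))).toLinearMap) =
        Module.finrank ℂ ↥(highestWeightSpace (coordRep (MatIdx m) ℂ m) (partitionWeightLex m lam) ⊓
          ⨅ (A : Matrix (MatIdx m) (MatIdx m) ℂ)
            (_ : n < m → ∀ s, A s (toLex ((0 : Fin m), (0 : Fin m))) = if s = topMatIdx m then 1 else 0),
            LinearMap.ker (aeval (R := ℂ) (S₁ := ℂ) fun e : DegIdx (MatIdx m) m =>
              (((e.1 (topMatIdx m) + j₂).descFactorial j₂ : ℕ) : ℂ) *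
                coeff e.1 (linSubst (MatIdx m) ℂ A (paddedPerFormLex ℂ n m))).toLinearMap) := by
  have h1 := orbitMultiplicity_rowLift_add_finrank_twistKer hnm lam hlam h₂ j₁
  have h2 := orbitMultiplicity_rowLift_add_finrank_twistKer hnm lam hlam h₂ j₂
  omega

/-- **Inheritance at a padding `j` from the BOTTOM of the ray, as a kernel comparison.**  For `n ≤ m`,
`λ ⊢ m·δ` with at most `m²` parts and `λ₂ ≤ m`:
`mult_{λ*} ℂ[Δ_m(X₀₀^{m-n} per_n)] ≤ mult_{(λ♯(m+j))*} ℂ[Δ_{m+j}(X₀₀^{m+j-n} per_n)]` holds iff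
`dim K_j(λ) ≤ dim K_0(λ)` (untwisted kernel on the right) — BLMW Problem 6.10 on the ray of `λ`,
position by position, is a statement about ONE family of diagonal twists of level-`m` evaluations.
[BLMW 2011 §6.4 Problem 6.10; this file] -/
theorem orbitMultiplicity_le_rowLift_iff {n m δ : ℕ} [NeZero m] (hnm : n ≤ m)
    (lam : Nat.Partition (m * δ)) (hlam : lam.parts.card ≤ m * m) (h₂ : lam.sortedParts.getD 1 0 ≤ m)
    (j : ℕ) [NeZero (m + j)] :
    orbitMultiplicity ℂ (paddedPerFormLex ℂ n m) m (partitionWeightLex m lam) ≤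
        orbitMultiplicity ℂ (paddedPerFormLex ℂ n (m + j)) (m + j) (partitionWeightLex (m + j) (rowLift lam j)) ↔
      Module.finrank ℂ ↥(highestWeightSpace (coordRep (MatIdx m) ℂ m) (partitionWeightLex m lam) ⊓
          ⨅ (A : Matrix (MatIdx m) (MatIdx m) ℂ)
            (_ : n < m → ∀ s, A s (toLex ((0 : Fin m), (0 : Fin m))) = if s = topMatIdx m then 1 else 0),
            LinearMap.ker (aeval (R := ℂ) (S₁ := ℂ) fun e : DegIdx (MatIdx m) m =>
              (((e.1 (topMatIdx m) + j).descFactorial j : ℕ) : ℂ) *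
                coeff e.1 (linSubst (MatIdx m) ℂ A (paddedPerFormLex ℂ n m))).toLinearMap) ≤
        Module.finrank ℂ ↥(highestWeightSpace (coordRep (MatIdx m) ℂ m) (partitionWeightLex m lam) ⊓
          ⨅ (A : Matrix (MatIdx m) (MatIdx m) ℂ)
            (_ : n < m → ∀ s, A s (toLex ((0 : Fin m), (0 : Fin m))) = if s = topMatIdx m then 1 else 0),
            LinearMap.ker (aeval (R := ℂ) (S₁ := ℂ)
              (formCoeff m (linSubst (MatIdx m) ℂ A (paddedPerFormLex ℂ n m)))).toLinearMap) := by
  have h1 := orbitMultiplicity_add_finrank_ker_bottom (n := n) lam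
  have h2 := orbitMultiplicity_rowLift_add_finrank_twistKer hnm lam hlam h₂ j
  omega

/-- **Upper bound by any subfamily of points.**  Since the twisted kernel only shrinks when more
vanishing conditions are imposed, every level-`m` family of column-normalised points `A_l` gives
`P(j) ≤ a_λ(δ[m]) - dim {G ∈ HWV_{λ*} : G(Δ_j(A_l · X₀₀^{m-n} per_n)) = 0 ∀ l}`... in the useful
direction: **`P(j) ≤ a_λ(δ[m]) - dim K_j(λ)` is an equality**, so ANY upper bound on the rank of the
twisted evaluation map (e.g. "every family of `D + 1` twisted functionals is dependent on
column-normalised points") is an upper bound `P(j) ≤ D` on the per side at padding `j` — the converse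
of the twisted-certificate lower bound `stub_twistedInheritance` / `twistedInheritance_padded`.
Stated as: `P(j) ≤ D` iff `a_λ(δ[m]) ≤ D + dim K_j(λ)`. [this file] -/
theorem orbitMultiplicity_rowLift_le_iff {n m δ : ℕ} [NeZero m] (hnm : n ≤ m)
    (lam : Nat.Partition (m * δ)) (hlam : lam.parts.card ≤ m * m) (h₂ : lam.sortedParts.getD 1 0 ≤ m)
    (j : ℕ) [NeZero (m + j)] (D : ℕ) :
    orbitMultiplicity ℂ (paddedPerFormLex ℂ n (m + j)) (m + j) (partitionWeightLex (m + j) (rowLift lam j)) ≤ D ↔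
      plethysmCoeff ℂ (MatIdx m) m (partitionWeightLex m lam) ≤ D +
        Module.finrank ℂ ↥(highestWeightSpace (coordRep (MatIdx m) ℂ m) (partitionWeightLex m lam) ⊓
          ⨅ (A : Matrix (MatIdx m) (MatIdx m) ℂ)
            (_ : n < m → ∀ s, A s (toLex ((0 : Fin m), (0 : Fin m))) = if s = topMatIdx m then 1 else 0),
            LinearMap.ker (aeval (R := ℂ) (S₁ := ℂ) fun e : DegIdx (MatIdx m) m =>
              (((e.1 (topMatIdx m) + j).descFactorial j : ℕ) : ℂ) *
                coeff e.1 (linSubst (MatIdx m) ℂ A (paddedPerFormLex ℂ n m))).toLinearMap) := by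
  have h := orbitMultiplicity_rowLift_add_finrank_twistKer hnm lam hlam h₂ j
  omega

end

end Summit.ValiantsHypothesis.ValiantsHypothesis.Theorems.ValuativeFlip
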